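import Summits.Parity.BatemanHorn.Theorems.SoloInformedConjEIffLargeDivisors

/-!
# The third range `(R3)_ε` overshoots: it contains Möbius cancellation along `n² + 1`

The schema `hardyLittlewoodConjE_of_twoRanges` reaches Conjecture E from the balanced-range
remainder hypothesis `(R2)_ε` and the third-range hypothesis `(R3)_ε` (uniform cancellation of
`μ((n²+1)/e)` over the classes `e ∣ n² + 1`, `e ≤ 2x^{1-ε} + 1`). This file records, kernel-checked,
that `(R3)_ε` is NOT a faithful residue of Conjecture E but a strictly stronger-looking input: its
single term `e = 1` already asserts
`∑_{n ≤ x} μ(n² + 1) = o(x / log x)` (`sum_moebius_sq_add_one_isLittleO_of_R3`),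
a Chowla-type cancellation statement for the irreducible quadratic `n² + 1` which is open and is not
known to follow from Conjecture E (for the state of the art on sign patterns of `λ(n²+1)` see
`Literature.NumberTheory.Sieve.teravainen2024_thm_2_3` and the module docstring of
`LiouvillePolynomialValues`: positive density of either sign is open). The faithful residue is the
plain large-divisor sum `T(x; x^{1-ε}) = o(x)` of `hardyLittlewoodConjE_iff_largeDivisorSum_isLittleO`,
which is EQUIVALENT to Conjecture E; `(R3)_ε` enters the schema only through the class-by-class
partial summation inside `abs_sum_vonMangoldt_sub_le` of `SoloInformedThreeRangeSchema`, where absolute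
values are taken for each `e` separately — that is where the equivalence is lost.
-/

namespace Summit.Parity.BatemanHorn.Theorems

open Finset Filter ArithmeticFunction Asymptotics
open scoped ArithmeticFunction.Moebius Topology

/-- The `e = 1` term of the `(R3)_ε` sum dominates `|∑_{n ≤ x} μ(n²+1)|` (every `x`, every level
`E`). -/
theorem abs_sum_moebius_sq_add_one_le_R3Sum (x E : ℕ) :
    |∑ n ∈ Icc 1 x, (μ (n ^ 2 + 1) : ℝ)|
      ≤ ∑ e ∈ Icc 1 (E + 1),
          (range (x + 1)).sup' nonempty_range_add_one (fun y =>
            |∑ n ∈ (Icc 1 y).filter (fun n => e ∣ n ^ 2 + 1), (μ ((n ^ 2 + 1) / e) : ℝ)|) := by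
  have h1 : (1 : ℕ) ∈ Icc 1 (E + 1) := by simp
  refine le_trans ?_ (single_le_sum (f := fun e => (range (x + 1)).sup' nonempty_range_add_one
    (fun y => |∑ n ∈ (Icc 1 y).filter (fun n => e ∣ n ^ 2 + 1), (μ ((n ^ 2 + 1) / e) : ℝ)|))
    (fun e _ => le_sup'_of_le _ (mem_range.mpr x.succ_pos) (abs_nonneg _)) h1)
  have hx : x ∈ range (x + 1) := self_mem_range_succ x
  refine le_trans (le_of_eq ?_) (le_sup' (fun y =>
    |∑ n ∈ (Icc 1 y).filter (fun n => 1 ∣ n ^ 2 + 1), (μ ((n ^ 2 + 1) / 1) : ℝ)|) hx)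
  simp only [Nat.div_one, one_dvd, filter_true_of_mem fun _ _ => trivial]

/-- **`(R3)_ε` implies `∑_{n ≤ x} μ(n² + 1) = o(x / log x)`** (hypothesis `(R3)_ε` verbatim as in
`hardyLittlewoodConjE_of_twoRanges`; any `ε`). -/
theorem sum_moebius_sq_add_one_isLittleO_of_R3 {ε : ℝ}
    (R3 : ∀ δ : ℝ, 0 < δ → ∀ᶠ x : ℕ in atTop,
      ∑ e ∈ Icc 1 (⌊2 * (x : ℝ) ^ (1 - ε)⌋₊ + 1),
          (range (x + 1)).sup' nonempty_range_add_one (fun y =>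
            |∑ n ∈ (Icc 1 y).filter (fun n => e ∣ n ^ 2 + 1), (μ ((n ^ 2 + 1) / e) : ℝ)|)
        ≤ δ * x / Real.log x) {δ : ℝ} (hδ : 0 < δ) :
    ∀ᶠ x : ℕ in atTop, |∑ n ∈ Icc 1 x, (μ (n ^ 2 + 1) : ℝ)| ≤ δ * x / Real.log x := by
  filter_upwards [R3 δ hδ] with x hx
  exact (abs_sum_moebius_sq_add_one_le_R3Sum x _).trans hx

/-- In particular `(R3)_ε` implies the Chowla-type statement `∑_{n ≤ x} μ(n² + 1) = o(x)`. -/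
theorem sum_moebius_sq_add_one_isLittleO_id_of_R3 {ε : ℝ}
    (R3 : ∀ δ : ℝ, 0 < δ → ∀ᶠ x : ℕ in atTop,
      ∑ e ∈ Icc 1 (⌊2 * (x : ℝ) ^ (1 - ε)⌋₊ + 1),
          (range (x + 1)).sup' nonempty_range_add_one (fun y =>
            |∑ n ∈ (Icc 1 y).filter (fun n => e ∣ n ^ 2 + 1), (μ ((n ^ 2 + 1) / e) : ℝ)|)
        ≤ δ * x / Real.log x) :
    (fun x : ℕ => ∑ n ∈ Icc 1 x, (μ (n ^ 2 + 1) : ℝ)) =o[atTop] fun x : ℕ => (x : ℝ) := by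
  rw [isLittleO_iff]
  intro c hc
  filter_upwards [sum_moebius_sq_add_one_isLittleO_of_R3 R3 hc, eventually_ge_atTop 3] with x hx hx3
  have hX : (3 : ℝ) ≤ x := by exact_mod_cast hx3
  have hlog1 : 1 ≤ Real.log x := by
    rw [← Real.exp_le_exp, Real.exp_log (by linarith)]
    exact (Real.exp_one_lt_d9.trans (by norm_num)).le.trans hX
  rw [Real.norm_eq_abs, Real.norm_eq_abs, Nat.abs_cast]
  refine hx.trans ?_
  rw [div_le_iff₀ (by linarith)]
  have : 0 ≤ c * x := by positivity
  nlinarith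

end Summit.Parity.BatemanHorn.Theorems
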